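import Literature.Geometry.Symplectic.JPlanePencilLeafFunction
import Literature.Geometry.Symplectic.PositivityOfIntersectionsLocalProofs
import Literature.Geometry.Symplectic.JSphereMeetsEmbeddedJSphere
import Literature.Geometry.Symplectic.JPlanePencilConstraintIndex
import HarnessLib

/-!
# Positivity of intersections of a `J`-curve with a leaf of an immersive family, via the leaf function

Support theorems (no named facts, D-0026) for
`Literature.Geometry.Symplectic.jPlanePencil_localFamily_homotopySphere`
(`JPlanePencilLocalFamily.lean`; C. Wendl, *Holomorphic Curves in Low Dimensions* (2018),
Prop. 2.53 with `m = 1`, for homotopy 4-spheres), continuing `JPlanePencilLeafFunction.lean`.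

Wendl, proof of Prop. 2.53 (last paragraph) with Thm. 2.49: two curves of the family, or a curve of
the family and any other closed `J`-curve in the same class, "are either identical or
disjoint" by positivity of intersections. Here the LOCAL half of that step is recorded in the
vocabulary of `JPlanePencilLeafFunction.lean`: a `J`-curve `u` crossing the leaf `{A = b}` of an
immersive family at `u ξ₀ = Φ (b, ξ₁)` either stays in the leaf near `ξ₀`, or the crossing is
isolated and the winding number of `A ∘ u − b` about it is `≥ 1` or `≤ −1` according to the
orientation class of `dA` relative to `J` at the point (`corePositivity_dichotomy`). The proof
feeds the leaf coordinate `a = α (A − b) + β conj (A − b)` — made complex linear at the crossing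
by `exists_complexLinearisation_coreLeafFn` — to the tree's PROVED positivity of intersections
`positivityOfIntersections_leafCoordinate_holds` (Wendl §2.2.2 / McDuff 1991 Thm. 1.1 /
Micallef–White 1995 Thm. 7.1), and transfers the winding number back through
`wind_mul_add_mul_conj_of_norm_lt(')`.

* `AlmostComplexStructure.ofPointwise` — the almost complex structure of the pencil statement
  (given pointwise with `J² = −1` and smooth `inTangentCoordinates` expressions) as an
  `AlmostComplexStructure (𝓡 4) ∞`, the input format of the positivity theorem.
* `corePositivity_dichotomy`.

## References

* C. Wendl, *Holomorphic Curves in Low Dimensions*, LNM 2216, Springer (2018), Prop. 2.53,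
  Thm. 2.49, §2.2.2. [Wendl2018]
* D. McDuff, *The local behaviour of holomorphic curves in almost complex 4-manifolds*,
  J. Differential Geom. 34 (1991), Thm. 1.1. [McDuff1991LocalBehaviour]
-/

noncomputable section

open scoped Manifold ContDiff Topology ComplexConjugate
open Set Function Filter Metric Complex Literature.Topology.PlaneTopology

namespace Literature.Geometry.Symplectic

/-! ### §1 An almost complex structure from pointwise data -/

section OfPointwise

variable {N : Type*} [TopologicalSpace N] [ChartedSpace (EuclideanSpace ℝ (Fin 4)) N]
  [IsManifold (𝓡 4) ∞ N]

/-- **An almost complex structure given pointwise**, with `J² = −1` and smooth frame expressions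
`inTangentCoordinates`, packaged as an `AlmostComplexStructure (𝓡 4) ∞ N`
(`contMDiffAt_hom_bundle`). This is how the pencil statement
`jPlanePencil_localFamily_homotopySphere` presents `J` on `M ∖ {p}`. [cite: Wendl2018, Prop. 2.53] -/
def AlmostComplexStructure.ofPointwise
    (J : ∀ x : N, TangentSpace (𝓡 4) x →L[ℝ] TangentSpace (𝓡 4) x)
    (hJ2 : ∀ (x : N) (v : TangentSpace (𝓡 4) x), J x (J x v) = -v)
    (hJs : ∀ x₀ : N, ContMDiffAt (𝓡 4) 𝓘(ℝ, EuclideanSpace ℝ (Fin 4) →L[ℝ] EuclideanSpace ℝ (Fin 4)) ∞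
      (inTangentCoordinates (𝓡 4) (𝓡 4) (id : N → N) id (fun x => J x) x₀) x₀) :
    AlmostComplexStructure (𝓡 4) ∞ N where
  toFun := J
  map_map' := hJ2
  contMDiff' := fun x₀ => by
    rw [contMDiffAt_hom_bundle]
    exact ⟨contMDiffAt_id, hJs x₀⟩

/-- `ofPointwise J _ _ x = J x`. [folklore] -/
theorem AlmostComplexStructure.ofPointwise_apply
    (J : ∀ x : N, TangentSpace (𝓡 4) x →L[ℝ] TangentSpace (𝓡 4) x)
    (hJ2 : ∀ (x : N) (v : TangentSpace (𝓡 4) x), J x (J x v) = -v)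
    (hJs : ∀ x₀ : N, ContMDiffAt (𝓡 4) 𝓘(ℝ, EuclideanSpace ℝ (Fin 4) →L[ℝ] EuclideanSpace ℝ (Fin 4)) ∞
      (inTangentCoordinates (𝓡 4) (𝓡 4) (id : N → N) id (fun x => J x) x₀) x₀) (x : N) :
    AlmostComplexStructure.ofPointwise J hJ2 hJs x = J x := rfl

end OfPointwise

/-! ### §2 Positivity at a crossing with a leaf of an immersive family -/

section Core

variable {X : Type} [TopologicalSpace X] [T2Space X] [SecondCountableTopology X]
  [ChartedSpace (EuclideanSpace ℝ (Fin 4)) X] [IsManifold (𝓡 4) ∞ X]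

omit [T2Space X] [SecondCountableTopology X] [IsManifold (𝓡 4) ∞ X] in
/-- The differential of a translate at `0`: `d(u ∘ (· + z₀))(0) = du(z₀)`. [folklore] -/
theorem mfderiv_comp_add_right_zero {u : ℂ → X} (hu : ContMDiff 𝓘(ℝ, ℂ) (𝓡 4) ∞ u) (z₀ : ℂ) :
    mfderiv 𝓘(ℝ, ℂ) (𝓡 4) (u ∘ fun z : ℂ => z + z₀) 0 = mfderiv 𝓘(ℝ, ℂ) (𝓡 4) u z₀ := by
  have h1 : HasMFDerivAt 𝓘(ℝ, ℂ) 𝓘(ℝ, ℂ) (fun z : ℂ => z + z₀) 0 (ContinuousLinearMap.id ℝ ℂ) :=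
    ((hasFDerivAt_id (𝕜 := ℝ) (0 : ℂ)).add_const z₀).hasMFDerivAt
  have h2 : HasMFDerivAt 𝓘(ℝ, ℂ) (𝓡 4) u ((fun z : ℂ => z + z₀) 0)
      (mfderiv 𝓘(ℝ, ℂ) (𝓡 4) u z₀) := by
    have h0 : (fun z : ℂ => z + z₀) 0 = z₀ := zero_add z₀
    rw [h0]
    exact ((hu z₀).mdifferentiableAt (by simp)).hasMFDerivAt
  rw [(h2.comp 0 h1).mfderiv]
  exact ContinuousLinearMap.ext fun v => rfl

/-- `ξ₀ + circleLoop 0 r t = circleLoop ξ₀ r t`. [folklore] -/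
theorem circleLoop_zero_add_eq (ξ₀ : ℂ) (r t : ℝ) : circleLoop 0 r t + ξ₀ = circleLoop ξ₀ r t := by
  have h := circleLoop_sub ξ₀ ξ₀ r t
  rw [sub_self] at h
  rw [← h, sub_add_cancel]

/-- **Positivity of intersections with a leaf of an immersive family (dichotomy).** Let `Φ` be
smooth, injective and immersive on the open box `B × C`, with leaf function `A = coreLeafFn`;
let the leaf `ξ ↦ Φ (b, ξ)` (`b ∈ B`) be a smooth `JX`-holomorphic map, and `u` a smooth
`JX`-holomorphic map with `u ξ₀ = Φ (b, ξ₁)`, `ξ₁ ∈ C`. Then EITHER `u` stays in the leaf near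
`ξ₀` (`A (u z) = b` for `z` near `ξ₀`), OR the crossing is isolated and, for all small `r > 0`,
`wind (A ∘ u ∘ circleLoop ξ₀ r − b)` is `≥ 1` if the orientation of `dA` relative to `JX` at the
crossing is positive (`Im (dA (J v) · conj (dA v)) > 0` for some/every `v ∉ ker dA`) and `≤ −1`
if it is negative. [cite: Wendl2018, Prop. 2.53 with Thm. 2.49 and §2.2.2] -/
theorem corePositivity_dichotomy (JX : AlmostComplexStructure (𝓡 4) ∞ X)
    {Φ : ℂ × ℂ → X} {B C : Set ℂ} (hB : IsOpen B) (hC : IsOpen C)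
    (hΦ : ContMDiffOn 𝓘(ℝ, ℂ × ℂ) (𝓡 4) ∞ Φ (B ×ˢ C)) (hinj : InjOn Φ (B ×ˢ C))
    (himm : ∀ q ∈ B ×ˢ C, Injective (mfderiv 𝓘(ℝ, ℂ × ℂ) (𝓡 4) Φ q))
    {b ξ₁ : ℂ} (hb : b ∈ B) (hξ₁ : ξ₁ ∈ C)
    (hleaf : ContMDiff 𝓘(ℝ, ℂ) (𝓡 4) ∞ fun ξ : ℂ => Φ (b, ξ))
    (hleafJ : IsJHolomorphic (𝓡 4) (fun y => JX y) fun ξ : ℂ => Φ (b, ξ))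
    {u : ℂ → X} (hu : ContMDiff 𝓘(ℝ, ℂ) (𝓡 4) ∞ u) (huJ : IsJHolomorphic (𝓡 4) (fun y => JX y) u)
    {ξ₀ : ℂ} (hcross : u ξ₀ = Φ (b, ξ₁)) :
    (∀ᶠ z in 𝓝 ξ₀, u z ∈ Φ '' (B ×ˢ C) ∧ coreLeafFn Φ (B ×ˢ C) (u z) = b) ∨
    ∃ r₀ : ℝ, 0 < r₀ ∧
      (∀ z : ℂ, 0 < ‖z - ξ₀‖ → ‖z - ξ₀‖ ≤ r₀ →
        u z ∈ Φ '' (B ×ˢ C) ∧ coreLeafFn Φ (B ×ˢ C) (u z) ≠ b) ∧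
      (∀ v : TangentSpace (𝓡 4) (Φ (b, ξ₁)),
        (show ℂ from mfderiv (𝓡 4) 𝓘(ℝ, ℂ) (coreLeafFn Φ (B ×ˢ C)) (Φ (b, ξ₁)) v) ≠ 0 →
        0 < ((show ℂ from mfderiv (𝓡 4) 𝓘(ℝ, ℂ) (coreLeafFn Φ (B ×ˢ C)) (Φ (b, ξ₁)) (JX _ v)) *
          (starRingEnd ℂ) (show ℂ from mfderiv (𝓡 4) 𝓘(ℝ, ℂ) (coreLeafFn Φ (B ×ˢ C)) (Φ (b, ξ₁)) v)).im →
        ∀ r : ℝ, 0 < r → r ≤ r₀ →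
          1 ≤ wind (fun t => coreLeafFn Φ (B ×ˢ C) (u (circleLoop ξ₀ r t)) - b)) ∧
      (∀ v : TangentSpace (𝓡 4) (Φ (b, ξ₁)),
        (show ℂ from mfderiv (𝓡 4) 𝓘(ℝ, ℂ) (coreLeafFn Φ (B ×ˢ C)) (Φ (b, ξ₁)) v) ≠ 0 →
        ((show ℂ from mfderiv (𝓡 4) 𝓘(ℝ, ℂ) (coreLeafFn Φ (B ×ˢ C)) (Φ (b, ξ₁)) (JX _ v)) *
          (starRingEnd ℂ) (show ℂ from mfderiv (𝓡 4) 𝓘(ℝ, ℂ) (coreLeafFn Φ (B ×ˢ C)) (Φ (b, ξ₁)) v)).im < 0 →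
        ∀ r : ℝ, 0 < r → r ≤ r₀ →
          wind (fun t => coreLeafFn Φ (B ×ˢ C) (u (circleLoop ξ₀ r t)) - b) ≤ -1) := by
  set D : Set (ℂ × ℂ) := B ×ˢ C with hD_def
  have hD : IsOpen D := hB.prod hC
  have hq : (b, ξ₁) ∈ D := ⟨hb, hξ₁⟩
  set A : X → ℂ := coreLeafFn Φ D with hA_def
  set N : Set X := Φ '' D with hN_def
  have hN : IsOpen N := isOpen_image_of_immersive hD hΦ himm
  have hAs : ContMDiffOn (𝓡 4) 𝓘(ℝ, ℂ) ∞ A N := contMDiffOn_coreLeafFn hD hΦ hinj himm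
  /- complex linearisation at the crossing -/
  have hhol : ∀ w : ℂ, mfderiv 𝓘(ℝ, ℂ × ℂ) (𝓡 4) Φ (b, ξ₁) (0, Complex.I * w) =
      JX _ (mfderiv 𝓘(ℝ, ℂ × ℂ) (𝓡 4) Φ (b, ξ₁) (0, w)) := fun w => by
    rw [← mfderiv_slice_apply_of_mem hD hΦ hq, ← mfderiv_slice_apply_of_mem hD hΦ hq]
    exact hleafJ ξ₁ w
  obtain ⟨α, β, hαβ, hlin, hpos, hneg⟩ :=
    exists_complexLinearisation_coreLeafFn hD hΦ hinj himm hq (JX _) (fun v => JX.map_map _ v) hhol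
  /- the leaf coordinate `a = α (A − b) + β conj (A − b)` -/
  set Mc : ℂ →L[ℝ] ℂ := α • ContinuousLinearMap.id ℝ ℂ + β • (Complex.conjCLE : ℂ →L[ℝ] ℂ) with hMc
  have hMc_apply : ∀ ζ, Mc ζ = α * ζ + β * conj ζ := fun ζ => by simp [hMc]
  set g : ℂ → ℂ := fun ζ => Mc (ζ - b) with hg_def
  have hg_deriv : ∀ ζ, HasFDerivAt g Mc ζ := fun ζ => by
    have h := (Mc.hasFDerivAt.comp ζ ((hasFDerivAt_id ζ).sub_const b))
    rw [ContinuousLinearMap.comp_id] at h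
    exact h
  have hg_smooth : ContDiff ℝ ∞ g := Mc.contDiff.comp (contDiff_id.sub contDiff_const)
  have hMc_bij : Bijective Mc := by
    have := bijective_mul_add_mul_conj hαβ
    refine ⟨fun x y hxy => this.1 ?_, fun z => ?_⟩
    · simpa [hMc_apply] using hxy
    · obtain ⟨x, hx⟩ := this.2 z
      exact ⟨x, by simpa [hMc_apply] using hx⟩
  have hg_zero_iff : ∀ ζ, g ζ = 0 ↔ ζ = b := fun ζ => by
    change Mc (ζ - b) = 0 ↔ ζ = b
    constructor
    · intro h
      have h1 : Mc (ζ - b) = Mc 0 := by rw [h, map_zero]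
      exact sub_eq_zero.1 (hMc_bij.1 h1)
    · intro h
      rw [h, sub_self, map_zero]
  set a : X → ℂ := fun y => g (A y) with ha_def
  have has : ContMDiffOn (𝓡 4) 𝓘(ℝ, ℂ) ∞ a N := fun y hy => hg_smooth.comp_contMDiffWithinAt (hAs y hy)
  -- differential of `a`: `da = Mc ∘ dA`
  have hda : ∀ y ∈ N, HasMFDerivAt (𝓡 4) 𝓘(ℝ, ℂ) a y (Mc.comp (mfderiv (𝓡 4) 𝓘(ℝ, ℂ) A y)) := by
    intro y hy
    have hAd : MDifferentiableAt (𝓡 4) 𝓘(ℝ, ℂ) A y :=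
      (hAs.contMDiffAt (hN.mem_nhds hy)).mdifferentiableAt (by simp)
    exact (hg_deriv (A y)).hasMFDerivAt.comp y hAd.hasMFDerivAt
  have hsubm : ∀ y ∈ N, Surjective (mfderiv (𝓡 4) 𝓘(ℝ, ℂ) a y) := by
    rintro y ⟨q', hq', rfl⟩
    rw [(hda _ ⟨q', hq', rfl⟩).mfderiv]
    exact hMc_bij.2.comp (surjective_mfderiv_coreLeafFn hD hΦ hinj himm hq')
  /- the recentred curves -/
  set u' : ℂ → X := u ∘ fun z : ℂ => z + ξ₀ with hu'
  set w' : ℂ → X := (fun ξ : ℂ => Φ (b, ξ)) ∘ fun z : ℂ => z + ξ₁ with hw'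
  have hu's : ContMDiff 𝓘(ℝ, ℂ) (𝓡 4) ∞ u' := contMDiff_comp_add_right hu ξ₀
  have hw's : ContMDiff 𝓘(ℝ, ℂ) (𝓡 4) ∞ w' := contMDiff_comp_add_right hleaf ξ₁
  have hu'J : IsJHolomorphic (𝓡 4) (fun y => JX y) u' := huJ.comp_add_right hu ξ₀
  have hw'J : IsJHolomorphic (𝓡 4) (fun y => JX y) w' := hleafJ.comp_add_right hleaf ξ₁
  have h0 : u' 0 = w' 0 := by simp [hu', hw', hcross]
  have hw'0 : w' 0 = Φ (b, ξ₁) := by simp [hw']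
  have hw'imm : Injective (mfderiv 𝓘(ℝ, ℂ) (𝓡 4) w' 0) := by
    refine injective_mfderiv_comp_add_right hleaf ?_
    rw [(hasMFDerivAt_slice_of_mem hD hΦ hq).mfderiv]
    intro v₁ v₂ hv
    have h1 : ((0 : ℂ), (v₁ : ℂ)) = ((0 : ℂ), (v₂ : ℂ)) := himm _ hq hv
    exact (Prod.ext_iff.1 h1).2
  have hw'0N : w' 0 ∈ N := by rw [hw'0]; exact ⟨_, hq, rfl⟩
  /- the zero set of `a` near the crossing is the leaf -/
  set V : Set ℂ := (fun z : ℂ => z + ξ₁) ⁻¹' C with hV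
  have hVn : V ∈ 𝓝 (0 : ℂ) :=
    (continuous_id.add continuous_const).continuousAt.preimage_mem_nhds
      (hC.mem_nhds (by simpa using hξ₁))
  have hzero : {x | x ∈ N ∧ a x = 0} = w' '' V := by
    have hlevel := coreLeafFn_levelSet (Φ := Φ) (B := B) (C := C) hinj hb
    apply Subset.antisymm
    · rintro x ⟨hxN, hax⟩
      have hAx : A x = b := (hg_zero_iff _).1 hax
      have hx : x ∈ {y | y ∈ Φ '' (B ×ˢ C) ∧ coreLeafFn Φ (B ×ˢ C) y = b} := ⟨hxN, hAx⟩
      rw [hlevel] at hx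
      obtain ⟨⟨b₁, ξ⟩, ⟨hb₁, hξC⟩, rfl⟩ := hx
      rw [mem_singleton_iff] at hb₁
      subst hb₁
      exact ⟨ξ - ξ₁, by simp [hV, hξC], by simp [hw']⟩
    · rintro x ⟨z, hz, rfl⟩
      have hmem : Φ (b, z + ξ₁) ∈ {y | y ∈ Φ '' (B ×ˢ C) ∧ coreLeafFn Φ (B ×ˢ C) y = b} := by
        rw [hlevel]
        exact ⟨(b, z + ξ₁), ⟨mem_singleton b, hz⟩, rfl⟩
      exact ⟨hmem.1, (hg_zero_iff _).2 hmem.2⟩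
  /- complex linearity of `da` at the crossing -/
  have hcl : ∀ v : TangentSpace (𝓡 4) (w' 0),
      (show ℂ from mfderiv (𝓡 4) 𝓘(ℝ, ℂ) a (w' 0) (JX (w' 0) v)) =
        Complex.I * (show ℂ from mfderiv (𝓡 4) 𝓘(ℝ, ℂ) a (w' 0) v) := by
    rw [hw'0]
    intro v
    rw [(hda _ ⟨_, hq, rfl⟩).mfderiv]
    show Mc (mfderiv (𝓡 4) 𝓘(ℝ, ℂ) A (Φ (b, ξ₁)) (JX _ v)) =
      Complex.I * Mc (mfderiv (𝓡 4) 𝓘(ℝ, ℂ) A (Φ (b, ξ₁)) v)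
    rw [hMc_apply, hMc_apply]
    exact hlin v
  /- apply positivity of intersections -/
  have hP := positivityOfIntersections_leafCoordinate_holds X JX u' w' N a hu's hu'J hw's hw'J h0
    hw'imm hN hw'0N has hsubm ⟨V, hVn, N, hN.mem_nhds hw'0N, Subset.rfl, hzero⟩ hcl
  rcases hP with hP | ⟨r₀, hr₀, hiso, hwind, -⟩
  · left
    rw [← eventually_nhds_add_right_iff (z₀ := ξ₀)]
    filter_upwards [hP] with z hz
    exact ⟨hz.1, (hg_zero_iff _).1 hz.2⟩
  · right
    refine ⟨r₀, hr₀, fun z hz0 hz => ?_, fun v hv hvpos r hr hrr₀ => ?_, fun v hv hvneg r hr hrr₀ => ?_⟩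
    · have h := hiso (z - ξ₀) hz0 hz
      simp only [hu', Function.comp_apply, sub_add_cancel] at h
      exact ⟨h.1, fun hA => h.2 ((hg_zero_iff _).2 hA)⟩
    · -- positive orientation: `wind (a ∘ u') = wind (A ∘ u − b) ≥ 1`
      have hβα : ‖β‖ < ‖α‖ := (hpos v hv).2 hvpos
      have hw := hwind r hr hrr₀
      have hloop : IsNonvanishingLoop fun t => A (u (circleLoop ξ₀ r t)) - b := by
        refine ⟨?_, fun t _ => ?_, by simp [circleLoop_zero_eq]⟩
        · have hc : ∀ t, u (circleLoop ξ₀ r t) ∈ N := fun t => by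
            have h := (hiso (circleLoop 0 r t) (by rw [norm_circleLoop_zero hr]; exact hr)
              (by rw [norm_circleLoop_zero hr]; exact hrr₀)).1
            simpa [hu', circleLoop_zero_add_eq] using h
          have hcu : Continuous fun t => u (circleLoop ξ₀ r t) :=
            hu.continuous.comp (continuous_circleLoop ξ₀ r)
          exact ((hAs.continuousOn.comp_continuous hcu hc).sub continuous_const).continuousOn
        · have h := (hiso (circleLoop 0 r t) (by rw [norm_circleLoop_zero hr]; exact hr)
            (by rw [norm_circleLoop_zero hr]; exact hrr₀)).2
          simp only [hu', Function.comp_apply, circleLoop_zero_add_eq] at h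
          exact fun h0 => h ((hg_zero_iff _).2 (sub_eq_zero.1 h0))
      have heq : (fun t => a (u' (circleLoop 0 r t))) =
          fun t => α * (A (u (circleLoop ξ₀ r t)) - b) + β * conj (A (u (circleLoop ξ₀ r t)) - b) := by
        funext t
        simp only [ha_def, hg_def, hu', Function.comp_apply, circleLoop_zero_add_eq, hMc_apply]
      rw [heq, wind_mul_add_mul_conj_of_norm_lt hloop hβα] at hw
      exact hw
    · have hαβ' : ‖α‖ < ‖β‖ := (hneg v hv).2 hvneg
      have hw := hwind r hr hrr₀
      have hloop : IsNonvanishingLoop fun t => A (u (circleLoop ξ₀ r t)) - b := by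
        refine ⟨?_, fun t _ => ?_, by simp [circleLoop_zero_eq]⟩
        · have hc : ∀ t, u (circleLoop ξ₀ r t) ∈ N := fun t => by
            have h := (hiso (circleLoop 0 r t) (by rw [norm_circleLoop_zero hr]; exact hr)
              (by rw [norm_circleLoop_zero hr]; exact hrr₀)).1
            simpa [hu', circleLoop_zero_add_eq] using h
          have hcu : Continuous fun t => u (circleLoop ξ₀ r t) :=
            hu.continuous.comp (continuous_circleLoop ξ₀ r)
          exact ((hAs.continuousOn.comp_continuous hcu hc).sub continuous_const).continuousOn
        · have h := (hiso (circleLoop 0 r t) (by rw [norm_circleLoop_zero hr]; exact hr)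
            (by rw [norm_circleLoop_zero hr]; exact hrr₀)).2
          simp only [hu', Function.comp_apply, circleLoop_zero_add_eq] at h
          exact fun h0 => h ((hg_zero_iff _).2 (sub_eq_zero.1 h0))
      have heq : (fun t => a (u' (circleLoop 0 r t))) =
          fun t => α * (A (u (circleLoop ξ₀ r t)) - b) + β * conj (A (u (circleLoop ξ₀ r t)) - b) := by
        funext t
        simp only [ha_def, hg_def, hu', Function.comp_apply, circleLoop_zero_add_eq, hMc_apply]
      rw [heq, wind_mul_add_mul_conj_of_norm_lt' hloop hαβ'] at hw
      omega

end Core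

end Literature.Geometry.Symplectic
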